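import Literature.AlgebraicGeometry.Deformation.RelativeCurvilinearLiftingNonClosedField
import Literature.AlgebraicGeometry.Deformation.ObstructionSpaceDimensionBound
import Literature.AlgebraicGeometry.Deformation.SmallExtensionFactorization
import Literature.AlgebraicGeometry.Deformation.TangentSpaceOfPoints
import Literature.RingTheory.CompleteLocalRings.DualNumberPoints
import Mathlib.RingTheory.AdjoinRoot
import Mathlib.RingTheory.Ideal.Quotient.Nilpotent
import HarnessLib

/-!
# [FM98] «if `k` is not algebraically closed then Proposition 5.8 may fail, cf. Example 5.7 (iii)»: the curve
# selection lemma (Lemma 5.4) and the relative dimension formula (Prop. 5.8) over an ordered field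

[FantechiManetti1998ObstructionCalculus] = B. Fantechi, M. Manetti, «Obstruction calculus for functors of Artin
rings, I», J. Algebra 202 (1998) 541–576 (held publisher text layer, store `paper:doi-10-1006-jabr-1997-7239`; page
`p00NN` = printed p. `540 + NN`), AS PRINTED:

* p. 546 (p0006 L5–7), DEFINITION 2.5: «Given a morphism `ν : F → G` in Fun, we define the tangent space to `F` to be
  the set `t_F = F(k[ε])`; we define the relative tangent space `t_ν` to `ν` to be the kernel of `t_F → t_G`.»
* p. 548 (p0008 L19–23, L29–35), DEFINITION 2.14: «For any morphism `ν : F → G` in Fun, define a covariant functor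
  `ν̃ : Smex → Set_∗` by setting for every small extension `e : 0 → M → B → A → 0`, `ν̃(e) = G(B) ×_{G(A)} F(A)`.»;
  DEFINITION 2.15: «A morphism `ν : F → G` in Fun is smooth if, for every `e ∈ Smex`, … the natural map
  `F(B) → ν̃(e)` is surjective. … Here we just recall that, if `ν` is smooth, then `F(A) → G(A)` is surjective for all
  `A ∈ Art_k`.» (`Set_∗` = pointed sets, p. 543 l. 13; DEFINITION 2.1, p. 545 (p0005 L17–19): a functor of Artin rings is
  «`F : Art_k → Set_∗` such that `F(k) = ∗`», by the Remark there «equivalent to ask that `F` be a functor with values in Set»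
  with `F(k)` one point.)
* p. 559 (p0019 L24–26), DEFINITION 5.1: «Let `R ∈ Ârt_k` and let `𝔪 = 𝔪_R`. Define `T¹_R = (𝔪/𝔪²)^∨`,
  `T²_R = Ex(R, k)`. We call `dim_k T¹_R` the embedding dimension of `R`.»; p. 560 (p0020 L8–10), PROPOSITION 5.3:
  «(i) `h_R` is left-exact, in particular satisfies (H1), …, (H4); (ii) `t_{h_R}` is canonically isomorphic to `T¹_R`;
  …».
* p. 560 (p0020 L74–77), LEMMA 5.4 (Curve Selection Lemma): «Let `k` be an algebraically closed field. Let
  `R ∈ Ârt_k`, and `g ∈ 𝔪_R` a non-nilpotent element. Then there is a local homomorphism `c : R → k[[t]]` such that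
  `c(g) ≠ 0`.» (proof, p0020 L79 – p0021 L6: «… Now `R` has dimension 1 and is a domain; embed it into its integral
  closure `R̃`. As `k` is algebraically closed, `R̃` is isomorphic to `k[[t]]` …»).
* p. 562 (p0022 L9–11), EXAMPLE 5.7 (iii): «Let `k = ℝ`, `R = k[[x, y]]/(x² + y²)`, `S = k[[x, y]]/(x², y²)`, and
  `R → S` be the natural projection. Then the morphism `h_S → h_R` has no curvilinear obstructions.»
* p. 562 (p0022 L12–22), «Remark. The above examples show that a morphism in Gdt without relative curvilinear
  obstructions is not necessarily smooth, even in the prorepresentable case and algebraically closed ground field.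
  Therefore the above Lemma 5.6 does not generalize to the relative case; the best result we can prove is the
  following: PROPOSITION 5.8. Let `k` be an algebraically closed field, and let `S → R` be a morphism in `Ârt_k`.
  Assume that `h_R → h_S` has no relative curvilinear obstructions. Then `S_red → R_red` is smooth, and
  `dim R − dim S = dim t_R − dim t_S`.» (proof, p0022 L23–42, from Cor. 4.13, Thm. 4.6 and LEMMA 5.4: «Otherwise, by
  Lemma 5.4 there exists a `c : P → k[[t]]` in `Ârt_k` such that `c(J) = 0`, `c(I) ≠ 0` …»).
* p. 562 (p0022 L46–47): «Note also that if `k` is not algebraically closed then Proposition 5.8 may fail, cf.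
  Example 5.7 (iii).»

WHAT IS TYPED (theorems only; `P = k[[x, y]] = MvPowerSeries (Fin 2) k`, the two rings of Example 5.7 (iii) are the
quotients of `P` by the inline ideals `(x² + y²)` and `(x², y²)` exactly as in the sibling tree file
`RelativeCurvilinearLiftingNonClosedField.lean`, whose `FM98Example57iii.relative_curvilinear_lifting` IS the hypothesis
«`h_S → h_R` has no (relative) curvilinear obstructions» of Prop. 5.8 for the morphism `R → S` of (iii), over any
ordered field `k` — print: `k = ℝ`):

§1 (`ProRep`, any field, any `n`) the embedding dimension of Def. 5.1 for the presentations of the tree: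
`ProRep.powerSeries_finrank_cotangentSpace_quotient_eq` — for `I ⊆ 𝔪²_P`, `P = k[[x_1, …, x_n]]`,
`dim_k 𝔪_R/𝔪_R² = n` for `R = P/I` (the tree's `ProRep.powerSeries_spanFinrank_maximalIdeal_quotient_eq`, «`μ(𝔪_R) = n`»,
through Nakayama in the form `Literature.RingTheory.CompleteLocalRings.TangentHom.finrank_cotangentSpace_eq_spanFinrank`);
`…_finrank_dual_cotangentSpace_quotient_eq` — `dim_k T¹_R = dim_k (𝔪_R/𝔪_R²)^∨ = n`; and the augmentation form
`…_finrank_kerCotangent_quotient_eq` — `dim_k (ker π)/(ker π)² = n` for EVERY augmentation `π : R → k` (this is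
`t_{h_R} = h_R(k[ε])` of Def. 2.5 up to the tree's `TangentHom.equivDual : t_R ≃ ((ker π)/(ker π)²)^∨` of
`Literature/RingTheory/CompleteLocalRings/DualNumberPoints.lean`, i.e. Prop. 5.3 (ii) «`t_{h_R} ≅ T¹_R`»; an
augmentation exists, `ProRep.quotientAug`); and §1b «`t_F = F(k[ε])`» LITERALLY: `ProRep.powerSeries_quotient_points_base_eq`
(`h_R(k)` is one point) and `ProRep.powerSeries_finrank_pointsTangent_eq` — `dim_k h_R(k[ε]) = n` for Schlessinger's vector space
structure on `h_R(k[ε])` (the tree's `ArtinFunctor.tangentModule` ∕ `ArtinFunctor.pointsTangentEquivCotangentDual` of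
`TangentSpaceVectorSpace.lean` ∕ `TangentSpaceOfPoints.lean`, [Schlessinger1968, Lemma 2.10, (2.6)]).
§2 (`FM98Example57iii`, any field) the four numbers of (iii): `ringKrullDim_quotient_sq_add_sq` — `dim k[[x, y]]/(x² + y²) = 1`
(Krull's height theorem and its converse for one nonzero equation, tree `ProRep.powerSeries_le_ringKrullDim_quotient_add_card`
∕ `ProRep.powerSeries_ringKrullDim_quotient_add_one_le`); `ringKrullDim_quotient_sq_sq` — `dim k[[x, y]]/(x², y²) = 0` (finite
over `k`: `𝔪³_P ⊆ (x², y²)`, `moduleFinite_quotient_sq_sq`, hence Artinian); `finrank_kerCotangent_quotient_sq_add_sq` ∕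
`…_sq_sq` (and the `CotangentSpace` forms) — both embedding dimensions are `2` (both ideals lie in `𝔪²_P`) —, and
`finrank_pointsTangent_quotient_sq_add_sq` ∕ `…_sq_sq`: `dim_k h_R(k[ε]) = dim_k h_S(k[ε]) = 2` literally.
§3 LEMMA 5.4 NEEDS «`k` algebraically closed» — this file's remark, the mechanism behind print's «Proposition 5.8 may
fail»: for `R = k[[x, y]]/(x² + y²)`, `g = x̄`: `FM98Example57iii.mk_X_pow_ne_zero` — `x̄` is NOT nilpotent (ANY field `k`:
the `k`-algebra map `k[[x, y]] → K[[t]]`, `x ↦ t`, `y ↦ j t`, `K = k[j]/(j² + 1)`, kills `x² + y²` and no power of `x`;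
Mathlib's `MvPowerSeries.substAlgHom`, `AdjoinRoot`); `mk_X_not_isUnit` — `x̄ ∈ 𝔪_R`; and, over an ORDERED field,
`curve_apply_mk_X_eq_zero` — EVERY `k`-algebra map `c : R → k[[t]]` kills `x̄` (and `ȳ`): `c(x)² + c(y)² = 0` in `k[[t]]`
forces `c(x) = 0`, the lowest coefficients being squares which cannot cancel (`T1Lifting.powerSeries_eq_zero_of_sq_add_sq_eq_zero`,
the `k[[t]]`-form of the tree's `T1Lifting.X_pow_dvd_sq_of_X_pow_dvd_sq_add_sq`); together `curveSelection_fails`: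
the conclusion of Lemma 5.4 fails for `(R, x̄)` over every ordered field.
§4 THE PRINTED SENTENCE p. 562 L46–47, `FM98Example57iii.prop58_fails` (ordered `k`): the hypothesis of Prop. 5.8 holds for
the morphism `R → S` of (iii) (tree, `relative_curvilinear_lifting`) while `dim R = 1`, `dim S = 0`,
`dim t_R = dim t_S = 2`; so Prop. 5.8's dimension formula — which for (iii) (print's `S → R` of 5.8 being (iii)'s `R → S`)
reads `dim S − dim R = dim t_S − dim t_R`, i.e. `0 − 1 = 2 − 2` — is false: `prop58_dimensionFormula_fails`
(`dim S + dim t_R ≠ dim R + dim t_S`, subtraction-free).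
§5 THE FIRST CONCLUSION «`S_red → R_red` is smooth» ALSO FAILS for (iii), for EVERY field `k` (this file's remark; print
only says «may fail»): with `R_red = k[[x, y]]/√(x² + y²)`, `S_red = k[[x, y]]/√(x², y²)` (`= k`:
`radical_span_sq_sq_eq_maximalIdeal`; these ARE the reductions `(P/I)/nil(P/I)`, `reduced_presentations` ∕
`ProRep.nonempty_quotient_nilradical_algEquiv_quotient_radical`), the morphism of functors `h_{S_red} → h_{R_red}` induced
by `ρ : R_red → S_red` is NOT smooth in the sense of Def. 2.14–2.15 (a morphism of `Ârt_k` being smooth when the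
induced morphism of functors of points is, [Schlessinger1968, §2]): `reducedMap_not_smooth` — on the small extension
`k[ε] → k` the map `h_{S_red}(k[ε]) → h_{S_red}(k) ×_{h_{R_red}(k)} h_{R_red}(k[ε])` misses the pair `(a, b)` with `b` a
NONZERO TANGENT VECTOR of `R_red` (`exists_point_dualNumber_ne_trivial`: `R_red` is Noetherian local and not a field —
`x̄ ≠ 0`, §3 — so `𝔪/𝔪² ≠ 0` by Nakayama, and a functional `ℓ ≠ 0` on it is a point `a ↦ π(a) + ℓ[a − π(a)]ε` of
`h_{R_red}(k[ε])`, the tree's `TangentHom.ofDual`), every `b' ∘ ρ` killing `x̄, ȳ ∈ √(x², y²)/√(x² + y²)`.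

HONEST SCOPE. (1) Lemma 5.4 itself (for `k = k̄`) and Prop. 5.8 itself are NOT typed (the proof of 5.4 passes through
the normalisation `R̃ ≅ k[[t]]` of a one-dimensional complete local domain). (2) `R_red` is presented as
`k[[x, y]]/√(x² + y²)` without computing the radical (`R = k[[x, y]]/(x² + y²)` is in fact a domain when `k` is ordered,
`R_red = R` — not typed, not needed); smoothness is tested only in the functor-of-points form of Def. 2.15 on the one
small extension `k[ε] → k` (enough to refute it); no equivalence «smooth ⇔ power series algebra» is used or typed here.
(3) «`dim t_R`» is typed three ways — Def. 5.1's
`T¹_R = (𝔪_R/𝔪_R²)^∨`, its augmentation-ideal form, and Def. 2.5's `t_{h_R} = h_R(k[ε])` with Schlessinger's vector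
space structure (§1b; the identification Prop. 5.3 (ii) is the tree's `ArtinFunctor.pointsTangentEquivCotangentDual` ∕
`TangentHom.equivDual`, used, not re-derived); the relative tangent space `t_ν` of Def. 2.5 is not typed. (4) `dim` is Mathlib's `ringKrullDim`; `R ∈ Ârt_k` (complete local
Noetherian with residue field `k`) is not asserted as a structure — the rings are the displayed quotients of `k[[x, y]]`.
(5) Print has `k = ℝ`; the arc statements of §3 and §4 hold for every linearly ordered field, §1–§2, the non-nilpotency
and §5 for every field. No obstruction theory and no geometric object is instantiated; nothing here says HC ∕ HC_CM ∕
HC_AV is proved, or that any functor of any cell object is smooth or unobstructed.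

## References

* B. Fantechi, M. Manetti, *Obstruction calculus for functors of Artin rings, I*, J. Algebra 202 (1998) 541–576:
  Def. 2.5 (p. 546), Def. 5.1 (p. 559), Prop. 5.3 (ii), Lemma 5.4 (p. 560), Example 5.7 (iii), Remark, Prop. 5.8 and
  the note after its proof (p. 562). [FantechiManetti1998ObstructionCalculus]
* M. Schlessinger, *Functors of Artin rings*, Trans. AMS 130 (1968) 208–222: §2 (Def. 2.2 smooth morphisms of
  functors; Prop. 2.5 (i)), Lemma 2.10 (`k[V]`, `t_F`). [Schlessinger1968]
* H. Matsumura, *Commutative Ring Theory*, CUP 1986: §14 (embedding dimension), Thm. 13.5, Thm. 13.6 (ii).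
  [Matsumura1987]
* M. F. Atiyah, I. G. Macdonald, *Introduction to Commutative Algebra*, 1969: Cor. 11.18; Ch. 8 (Artin rings have
  dimension `0`, Thm. 8.5). [AtiyahMacdonald1969]
* B. Mazur, *An introduction to the deformation theory of Galois representations* (1997), §15 (`t_R = Hom(R, k[ε])`
  is dual to `𝔪_R/(𝔪_R²)`). [Mazur1997Deformation]
-/

open MvPowerSeries

namespace Literature.AlgebraicGeometry.Deformation

universe u

variable (k : Type u) [Field k]

/-! ### §1 The embedding dimension of `k[[x_1, …, x_n]]/I`, `I ⊆ 𝔪²`, as a `k`-dimension ([FM98] Def. 5.1) -/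

namespace ProRep

variable {k}

/-- An ideal inside `𝔪²_P` is proper. [folklore] -/
private theorem ne_top_of_le_maximalIdeal_sq' {n : ℕ} {I : Ideal (MvPowerSeries (Fin n) k)}
    (hI : I ≤ (IsLocalRing.maximalIdeal (MvPowerSeries (Fin n) k)) ^ 2) : I ≠ ⊤ := fun h =>
  (IsLocalRing.maximalIdeal.isMaximal (MvPowerSeries (Fin n) k)).ne_top
    (top_le_iff.1 ((h.symm.le.trans hI).trans (Ideal.pow_le_self two_ne_zero)))

/-- **[FantechiManetti1998ObstructionCalculus, Def. 5.1] «We call `dim_k T¹_R` the embedding dimension of `R`»,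
`T¹_R = (𝔪/𝔪²)^∨`, for the presentations of the tree**: for `R = k[[x_1, …, x_n]]/I` with `I ⊆ 𝔪²_P`,
`dim_k 𝔪_R/𝔪_R² = n` — the tree's «`μ(𝔪_R) = n`» (`powerSeries_spanFinrank_maximalIdeal_quotient_eq`, [Matsumura1987,
§14]) through Nakayama `μ(𝔪_R) = dim_k 𝔪_R/𝔪_R²` for a local Noetherian `k`-algebra with residue field `k`
(`Literature.RingTheory.CompleteLocalRings.TangentHom.finrank_cotangentSpace_eq_spanFinrank`, along the augmentation
`R → k`). [cite: FantechiManetti1998ObstructionCalculus, Def. 5.1] [cite: Matsumura1987, §14] -/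
theorem powerSeries_finrank_cotangentSpace_quotient_eq {n : ℕ} (I : Ideal (MvPowerSeries (Fin n) k))
    (hI : I ≤ (IsLocalRing.maximalIdeal (MvPowerSeries (Fin n) k)) ^ 2)
    [IsLocalRing (MvPowerSeries (Fin n) k ⧸ I)] :
    Module.finrank k (IsLocalRing.CotangentSpace (MvPowerSeries (Fin n) k ⧸ I)) = n := by
  haveI : IsNoetherianRing (MvPowerSeries (Fin n) k) :=
    Literature.AlgebraicGeometry.Resolution.isNoetherianRing_mvPowerSeries k (Fin n)
  rw [Literature.RingTheory.CompleteLocalRings.TangentHom.finrank_cotangentSpace_eq_spanFinrank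
      (quotientAug (mvPowerSeriesAug k n) I (ne_top_of_le_maximalIdeal_sq' hI)),
    powerSeries_spanFinrank_maximalIdeal_quotient_eq I hI]

/-- The same for `T¹_R = (𝔪_R/𝔪_R²)^∨` itself ([FantechiManetti1998ObstructionCalculus, Def. 5.1]): `dim_k T¹_R = n`
for `R = k[[x_1, …, x_n]]/I`, `I ⊆ 𝔪²_P` (a vector space and its dual have the same `finrank`).
[cite: FantechiManetti1998ObstructionCalculus, Def. 5.1] -/
theorem powerSeries_finrank_dual_cotangentSpace_quotient_eq {n : ℕ} (I : Ideal (MvPowerSeries (Fin n) k))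
    (hI : I ≤ (IsLocalRing.maximalIdeal (MvPowerSeries (Fin n) k)) ^ 2)
    [IsLocalRing (MvPowerSeries (Fin n) k ⧸ I)] :
    Module.finrank k (Module.Dual k (IsLocalRing.CotangentSpace (MvPowerSeries (Fin n) k ⧸ I))) = n := by
  rw [Subspace.dual_finrank_eq, powerSeries_finrank_cotangentSpace_quotient_eq I hI]

/-- The augmentation-ideal form (no local-ring instance needed in the statement): for `R = k[[x_1, …, x_n]]/I`,
`I ⊆ 𝔪²_P`, and ANY augmentation `π : R → k` (there is exactly one; `ker π = 𝔪_R`,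
`TangentHom.ker_eq_maximalIdeal`), `dim_k (ker π)/(ker π)² = n`. With the tree's
`TangentHom.equivDual : t_R ≃ ((ker π)/(ker π)²)^∨`, `t_R = {φ : R → k[ε] over π}`, this is the dimension of the
tangent space `t_{h_R} = h_R(k[ε])` of [FantechiManetti1998ObstructionCalculus, Def. 2.5] ∕ Prop. 5.3 (ii) «`t_{h_R}` is
canonically isomorphic to `T¹_R`». [cite: FantechiManetti1998ObstructionCalculus, Def. 2.5, Def. 5.1, Prop. 5.3 (ii)]
[cite: Mazur1997Deformation, §15] -/
theorem powerSeries_finrank_kerCotangent_quotient_eq {n : ℕ} (I : Ideal (MvPowerSeries (Fin n) k))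
    (hI : I ≤ (IsLocalRing.maximalIdeal (MvPowerSeries (Fin n) k)) ^ 2)
    (π : (MvPowerSeries (Fin n) k ⧸ I) →ₐ[k] k) :
    Module.finrank k (RingHom.ker π).Cotangent = n := by
  haveI : IsLocalRing (MvPowerSeries (Fin n) k ⧸ I) := isLocalRing_quotient I (ne_top_of_le_maximalIdeal_sq' hI)
  rw [Literature.RingTheory.CompleteLocalRings.TangentHom.ker_eq_maximalIdeal π]
  exact powerSeries_finrank_cotangentSpace_quotient_eq I hI

/-- Augmentations exist: `R = k[[x_1, …, x_n]]/I → k` for `I ⊆ 𝔪²_P` (so the `∀ π` statements above are not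
vacuous; the tree's `ProRep.quotientAug`). [cite: FantechiManetti1998ObstructionCalculus, Def. 5.1] -/
theorem powerSeries_quotient_nonempty_aug {n : ℕ} (I : Ideal (MvPowerSeries (Fin n) k))
    (hI : I ≤ (IsLocalRing.maximalIdeal (MvPowerSeries (Fin n) k)) ^ 2) :
    Nonempty ((MvPowerSeries (Fin n) k ⧸ I) →ₐ[k] k) :=
  ⟨quotientAug (mvPowerSeriesAug k n) I (ne_top_of_le_maximalIdeal_sq' hI)⟩

/-! #### §1b «`t_F = F(k[ε])`» literally: the functor-of-points tangent space of `k[[x_1, …, x_n]]/I` -/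

/-- `h_R(k)` is ONE point for `R = k[[x_1, …, x_n]]/I` (any ideal `I`): two `k`-algebra maps `R → k` agree — on
`k[[x]]` they kill the variables (a `k`-algebra map into an object of `Art_k` sends `x_i` into the maximal ideal,
`T1Lifting.algHom_X_mem_maximalIdeal`; that of `k` is `0`) and are then equal (`T1Lifting.mvPowerSeries_algHom_ext`). This is
print's normalisation «`F(k) = ∗`» for `F = h_R` ([FantechiManetti1998ObstructionCalculus, Def. 2.1, p. 545]; [Schlessinger1968, (2.6)]).
[cite: FantechiManetti1998ObstructionCalculus, Def. 2.1 (p. 545)] [cite: Schlessinger1968, (2.6), p. 211] -/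
theorem powerSeries_quotient_points_base_eq {n : ℕ} (I : Ideal (MvPowerSeries (Fin n) k))
    (a b : (ArtinFunctor.points (k := k) (MvPowerSeries (Fin n) k ⧸ I)).obj (ArtAlg.base k)) : a = b := by
  have hX : ∀ (c : (ArtinFunctor.points (k := k) (MvPowerSeries (Fin n) k ⧸ I)).obj (ArtAlg.base k)) (s : Fin n),
      (ArtinFunctor.pointsHom _ c).comp (Ideal.Quotient.mkₐ k I) (MvPowerSeries.X s) = 0 := fun c s => by
    have h := T1Lifting.algHom_X_mem_maximalIdeal k (ArtAlg.base k)
      ((ArtinFunctor.pointsHom _ c).comp (Ideal.Quotient.mkₐ k I)) s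
    have h0 : IsLocalRing.maximalIdeal (ArtAlg.base k : Type u) = ⊥ :=
      IsLocalRing.isField_iff_maximalIdeal_eq.1 (Field.toIsField k)
    rw [h0, Ideal.mem_bot] at h
    exact h
  have hcomp : (ArtinFunctor.pointsHom _ a).comp (Ideal.Quotient.mkₐ k I) =
      (ArtinFunctor.pointsHom _ b).comp (Ideal.Quotient.mkₐ k I) :=
    T1Lifting.mvPowerSeries_algHom_ext k (ArtAlg.base k) _ _ fun s => by rw [hX a s, hX b s]
  exact Ideal.Quotient.algHom_ext k hcomp

/-- **«`dim t_R`» with `t_R = t_{h_R} = h_R(k[ε])` LITERALLY** ([FantechiManetti1998ObstructionCalculus, Def. 2.5]: «the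
tangent space to `F` … the set `t_F = F(k[ε])`»; its `k`-vector space structure is Schlessinger's, [Schlessinger1968, Lemma
2.10], = the tree's `ArtinFunctor.tangentModule` of `TangentSpaceVectorSpace.lean`): for `R = k[[x_1, …, x_n]]/I` with
`I ⊆ 𝔪²_P`, `dim_k h_R(k[ε]) = n`. Proof: the tree's `ArtinFunctor.pointsTangentEquivCotangentDual`
(«`t_{h_R} ≅ (𝔪_R/𝔪_R²)^∨`», [Schlessinger1968, (2.6)] = [FantechiManetti1998ObstructionCalculus, Prop. 5.3 (ii)]
«`t_{h_R}` is canonically isomorphic to `T¹_R`») and §1 (`powerSeries_finrank_kerCotangent_quotient_eq`).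
[cite: FantechiManetti1998ObstructionCalculus, Def. 2.5, Prop. 5.3 (ii) and Def. 5.1] [cite: Schlessinger1968, (2.6) and Lemma 2.10] -/
theorem powerSeries_finrank_pointsTangent_eq {n : ℕ} (I : Ideal (MvPowerSeries (Fin n) k))
    (hI : I ≤ (IsLocalRing.maximalIdeal (MvPowerSeries (Fin n) k)) ^ 2)
    (pt : (ArtinFunctor.points (k := k) (MvPowerSeries (Fin n) k ⧸ I)).obj (ArtAlg.base k)) :
    letI := (ArtinFunctor.points (k := k) (MvPowerSeries (Fin n) k ⧸ I)).tangentAddCommGroup pt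
      (fun a => powerSeries_quotient_points_base_eq I a pt) k
      (ArtinFunctor.points_isBijectiveAlong_sqZeroExtAug (MvPowerSeries (Fin n) k ⧸ I) k)
    letI := (ArtinFunctor.points (k := k) (MvPowerSeries (Fin n) k ⧸ I)).tangentModule pt
      (fun a => powerSeries_quotient_points_base_eq I a pt) k
      (ArtinFunctor.points_isBijectiveAlong_sqZeroExtAug (MvPowerSeries (Fin n) k ⧸ I) k)
    Module.finrank k ((ArtinFunctor.points (k := k) (MvPowerSeries (Fin n) k ⧸ I)).obj (ArtAlg.sqZeroExt (k := k) k)) =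
      n := by
  letI := (ArtinFunctor.points (k := k) (MvPowerSeries (Fin n) k ⧸ I)).tangentAddCommGroup pt
    (fun a => powerSeries_quotient_points_base_eq I a pt) k
    (ArtinFunctor.points_isBijectiveAlong_sqZeroExtAug (MvPowerSeries (Fin n) k ⧸ I) k)
  letI := (ArtinFunctor.points (k := k) (MvPowerSeries (Fin n) k ⧸ I)).tangentModule pt
    (fun a => powerSeries_quotient_points_base_eq I a pt) k
    (ArtinFunctor.points_isBijectiveAlong_sqZeroExtAug (MvPowerSeries (Fin n) k ⧸ I) k)
  rw [(ArtinFunctor.pointsTangentEquivCotangentDual (MvPowerSeries (Fin n) k ⧸ I) pt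
      (fun a => powerSeries_quotient_points_base_eq I a pt)).finrank_eq, Subspace.dual_finrank_eq]
  exact powerSeries_finrank_kerCotangent_quotient_eq I hI (ArtinFunctor.pointsAug _ pt)

/-- **`R_red` for a presented ring**: for any `k`-algebra `A` and ideal `I`, the reduction `(A/I)_red = (A/I)/nil(A/I)`
IS `A/√I` — `nil(A/I) = √I·(A/I)` (`Ideal.map_radical_of_surjective`) and the third isomorphism theorem
(`DoubleQuot.quotQuotEquivQuotOfLEₐ`); and `A/√I` is reduced. (The form in which «`S_red`», «`R_red`» of
[FantechiManetti1998ObstructionCalculus, Prop. 5.8] are typed below.) [cite: FantechiManetti1998ObstructionCalculus, Prop. 5.8] -/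
theorem nonempty_quotient_nilradical_algEquiv_quotient_radical {A : Type u} [CommRing A] [Algebra k A]
    (I : Ideal A) :
    Nonempty (((A ⧸ I) ⧸ nilradical (A ⧸ I)) ≃ₐ[k] A ⧸ I.radical) ∧ IsReduced (A ⧸ I.radical) := by
  have h : I.radical.map (Ideal.Quotient.mkₐ k I) = nilradical (A ⧸ I) := by
    change I.radical.map (Ideal.Quotient.mk I) = (0 : Ideal (A ⧸ I)).radical
    rw [Ideal.map_radical_of_surjective Ideal.Quotient.mk_surjective (le_of_eq Ideal.mk_ker),
      Ideal.map_quotient_self, Ideal.zero_eq_bot]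
  exact ⟨⟨(Ideal.quotientEquivAlgOfEq k h.symm).trans (DoubleQuot.quotQuotEquivQuotOfLEₐ k I.le_radical)⟩,
    (Ideal.isRadical_iff_quotient_reduced _).1 I.radical_isRadical⟩

end ProRep

/-! ### §3a (ordered field) Sums of two squares do not vanish in `k[[t]]` -/

namespace T1Lifting

variable [LinearOrder k] [IsStrictOrderedRing k]

/-- Over an ordered field, `p² + q² = 0` in `k[[t]]` forces `p = 0`: at the least index `n` where `p` or `q` has a
nonzero coefficient, the coefficient of `t^{2n}` in `p² + q²` is `p_n² + q_n² > 0` (the `k[[t]]`-form of the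
computation behind [FantechiManetti1998ObstructionCalculus, Ex. 5.7 (iii)]; cf. the tree's polynomial form
`T1Lifting.X_pow_dvd_sq_of_X_pow_dvd_sq_add_sq`). [cite: FantechiManetti1998ObstructionCalculus, Ex. 5.7 (iii)] -/
theorem powerSeries_eq_zero_of_sq_add_sq_eq_zero {p q : PowerSeries k} (h : p ^ 2 + q ^ 2 = 0) : p = 0 := by
  classical
  by_contra hp
  have hex : ∃ n, PowerSeries.coeff n p ≠ 0 ∨ PowerSeries.coeff n q ≠ 0 := by
    by_contra hall
    push Not at hall
    exact hp (PowerSeries.ext fun n => by rw [(hall n).1, map_zero])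
  obtain ⟨hspec, hmin⟩ : (PowerSeries.coeff (Nat.find hex) p ≠ 0 ∨ PowerSeries.coeff (Nat.find hex) q ≠ 0) ∧
      ∀ i < Nat.find hex, PowerSeries.coeff i p = 0 ∧ PowerSeries.coeff i q = 0 :=
    ⟨Nat.find_spec hex, fun i hi => by simpa [not_or] using Nat.find_min hex hi⟩
  set n := Nat.find hex with hn
  have hsq : ∀ r : PowerSeries k, (∀ i < n, PowerSeries.coeff i r = 0) →
      PowerSeries.coeff (n + n) (r ^ 2) = PowerSeries.coeff n r * PowerSeries.coeff n r := fun r hr => by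
    rw [pow_two, PowerSeries.coeff_mul, Finset.sum_eq_single (n, n)]
    · rintro ⟨i, j⟩ hij hne
      rw [Finset.HasAntidiagonal.mem_antidiagonal] at hij
      rcases lt_or_ge i n with hi | hi
      · rw [hr i hi, zero_mul]
      · have hne' : ¬(i = n ∧ j = n) := fun h' => hne (Prod.ext h'.1 h'.2)
        have hj : j < n := by omega
        rw [hr j hj, mul_zero]
    · intro hnn
      exact (hnn (Finset.HasAntidiagonal.mem_antidiagonal.2 rfl)).elim
  have h2 := congrArg (PowerSeries.coeff (n + n)) h
  rw [map_add, hsq p fun i hi => (hmin i hi).1, hsq q fun i hi => (hmin i hi).2, map_zero] at h2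
  have hp0 : 0 ≤ PowerSeries.coeff n p * PowerSeries.coeff n p := mul_self_nonneg _
  have hq0 : 0 ≤ PowerSeries.coeff n q * PowerSeries.coeff n q := mul_self_nonneg _
  rcases hspec with hne | hne
  · have := mul_self_pos.2 hne
    linarith
  · have := mul_self_pos.2 hne
    linarith

/-- Hence a `k`-algebra map `φ : k[[x, y]] → k[[t]]` killing `x² + y²` kills `x` and `y` (`k` ordered): every arc
`c : R = k[[x, y]]/(x² + y²) → k[[t]]` is trivial on `x̄, ȳ` ([FantechiManetti1998ObstructionCalculus, Ex. 5.7 (iii)],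
the arc form). [cite: FantechiManetti1998ObstructionCalculus, Ex. 5.7 (iii)] -/
theorem algHom_X_eq_zero_of_map_sq_add_sq_eq_zero (φ : MvPowerSeries (Fin 2) k →ₐ[k] PowerSeries k)
    (hφ : φ ((X 0 : MvPowerSeries (Fin 2) k) ^ 2 + X 1 ^ 2) = 0) (s : Fin 2) : φ (X s) = 0 := by
  rw [map_add, map_pow, map_pow] at hφ
  fin_cases s
  · exact powerSeries_eq_zero_of_sq_add_sq_eq_zero k hφ
  · exact powerSeries_eq_zero_of_sq_add_sq_eq_zero k (by rwa [add_comm] at hφ)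

end T1Lifting

/-! ### §2 The two rings of [FM98] Example 5.7 (iii): `R = k[[x, y]]/(x² + y²)`, `S = k[[x, y]]/(x², y²)` -/

namespace FM98Example57iii

open FM98Example57

/-- `x, y ∈ 𝔪_P`, `P = k[[x, y]]`. [folklore] -/
private theorem X_mem_maximalIdeal (s : Fin 2) : (X s : P2 k) ∈ IsLocalRing.maximalIdeal (P2 k) := by
  rw [Literature.AlgebraicGeometry.Resolution.maximalIdeal_mvPowerSeries_eq_span]
  exact Ideal.subset_span ⟨s, rfl⟩

/-- `(x² + y²) ⊆ 𝔪²_P`: the presentation `R = P/I`, `I ⊆ 𝔪²_P`, of [FantechiManetti1998ObstructionCalculus, Lemma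
5.2 (ii)] for the ring `R` of Example 5.7 (iii). [cite: FantechiManetti1998ObstructionCalculus, Ex. 5.7 (iii)] -/
theorem span_sq_add_sq_le_maximalIdeal_sq :
    Ideal.span {(X 0 : P2 k) ^ 2 + X 1 ^ 2} ≤ IsLocalRing.maximalIdeal (P2 k) ^ 2 := by
  rw [Ideal.span_le, Set.singleton_subset_iff, SetLike.mem_coe]
  exact add_mem (Ideal.pow_mem_pow (X_mem_maximalIdeal k 0) 2) (Ideal.pow_mem_pow (X_mem_maximalIdeal k 1) 2)

/-- `(x², y²) ⊆ 𝔪²_P`: the same for the ring `S` of Example 5.7 (iii).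
[cite: FantechiManetti1998ObstructionCalculus, Ex. 5.7 (iii)] -/
theorem span_sq_sq_le_maximalIdeal_sq :
    Ideal.span {(X 0 : P2 k) ^ 2, X 1 ^ 2} ≤ IsLocalRing.maximalIdeal (P2 k) ^ 2 := by
  rw [Ideal.span_le]
  intro f hf
  simp only [Set.mem_insert_iff, Set.mem_singleton_iff] at hf
  rcases hf with rfl | rfl
  · exact Ideal.pow_mem_pow (X_mem_maximalIdeal k 0) 2
  · exact Ideal.pow_mem_pow (X_mem_maximalIdeal k 1) 2

/-- `(x² + y²) ≠ P`. [cite: FantechiManetti1998ObstructionCalculus, Ex. 5.7 (iii)] -/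
theorem span_sq_add_sq_ne_top : Ideal.span {(X 0 : P2 k) ^ 2 + X 1 ^ 2} ≠ ⊤ := fun h =>
  (IsLocalRing.maximalIdeal.isMaximal (P2 k)).ne_top
    (top_le_iff.1 ((h.symm.le.trans (span_sq_add_sq_le_maximalIdeal_sq k)).trans (Ideal.pow_le_self two_ne_zero)))

/-- `(x², y²) ≠ P`. [cite: FantechiManetti1998ObstructionCalculus, Ex. 5.7 (iii)] -/
theorem span_sq_sq_ne_top : Ideal.span {(X 0 : P2 k) ^ 2, X 1 ^ 2} ≠ ⊤ := fun h =>
  (IsLocalRing.maximalIdeal.isMaximal (P2 k)).ne_top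
    (top_le_iff.1 ((h.symm.le.trans (span_sq_sq_le_maximalIdeal_sq k)).trans (Ideal.pow_le_self two_ne_zero)))

/-- `R = k[[x, y]]/(x² + y²)` is a local ring. [cite: FantechiManetti1998ObstructionCalculus, Ex. 5.7 (iii)] -/
theorem isLocalRing_quotient_sq_add_sq : IsLocalRing (P2 k ⧸ Ideal.span {(X 0 : P2 k) ^ 2 + X 1 ^ 2}) :=
  ProRep.isLocalRing_quotient _ (span_sq_add_sq_ne_top k)

/-- `S = k[[x, y]]/(x², y²)` is a local ring. [cite: FantechiManetti1998ObstructionCalculus, Ex. 5.7 (iii)] -/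
theorem isLocalRing_quotient_sq_sq : IsLocalRing (P2 k ⧸ Ideal.span {(X 0 : P2 k) ^ 2, X 1 ^ 2}) :=
  ProRep.isLocalRing_quotient _ (span_sq_sq_ne_top k)

/-! #### `dim t_R = dim t_S = 2` -/

/-- **«`dim t_R`» for (iii)**: the embedding dimension of `R = k[[x, y]]/(x² + y²)` is `2` — `dim_k 𝔪_R/𝔪_R² = 2` (any
field `k`; [FantechiManetti1998ObstructionCalculus, Def. 5.1]). [cite: FantechiManetti1998ObstructionCalculus, Def. 5.1
and Ex. 5.7 (iii)] -/
theorem finrank_cotangentSpace_quotient_sq_add_sq [IsLocalRing (P2 k ⧸ Ideal.span {(X 0 : P2 k) ^ 2 + X 1 ^ 2})] :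
    Module.finrank k (IsLocalRing.CotangentSpace (P2 k ⧸ Ideal.span {(X 0 : P2 k) ^ 2 + X 1 ^ 2})) = 2 :=
  ProRep.powerSeries_finrank_cotangentSpace_quotient_eq _ (span_sq_add_sq_le_maximalIdeal_sq k)

/-- **«`dim t_S`» for (iii)**: the embedding dimension of `S = k[[x, y]]/(x², y²)` is `2` — `dim_k 𝔪_S/𝔪_S² = 2` (any
field `k`). [cite: FantechiManetti1998ObstructionCalculus, Def. 5.1 and Ex. 5.7 (iii)] -/
theorem finrank_cotangentSpace_quotient_sq_sq [IsLocalRing (P2 k ⧸ Ideal.span {(X 0 : P2 k) ^ 2, X 1 ^ 2})] :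
    Module.finrank k (IsLocalRing.CotangentSpace (P2 k ⧸ Ideal.span {(X 0 : P2 k) ^ 2, X 1 ^ 2})) = 2 :=
  ProRep.powerSeries_finrank_cotangentSpace_quotient_eq _ (span_sq_sq_le_maximalIdeal_sq k)

/-- «`dim t_R = 2`» in the augmentation-ideal form: for every augmentation `π : R → k`, `dim_k (ker π)/(ker π)² = 2`
(`= dim_k t_{h_R}`, `t_{h_R} = h_R(k[ε])`, by the tree's `TangentHom.equivDual`; Def. 2.5, Prop. 5.3 (ii)).
[cite: FantechiManetti1998ObstructionCalculus, Def. 2.5, Def. 5.1 and Ex. 5.7 (iii)] -/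
theorem finrank_kerCotangent_quotient_sq_add_sq (π : (P2 k ⧸ Ideal.span {(X 0 : P2 k) ^ 2 + X 1 ^ 2}) →ₐ[k] k) :
    Module.finrank k (RingHom.ker π).Cotangent = 2 :=
  ProRep.powerSeries_finrank_kerCotangent_quotient_eq _ (span_sq_add_sq_le_maximalIdeal_sq k) π

/-- «`dim t_S = 2`» in the augmentation-ideal form: for every augmentation `π : S → k`, `dim_k (ker π)/(ker π)² = 2`.
[cite: FantechiManetti1998ObstructionCalculus, Def. 2.5, Def. 5.1 and Ex. 5.7 (iii)] -/
theorem finrank_kerCotangent_quotient_sq_sq (π : (P2 k ⧸ Ideal.span {(X 0 : P2 k) ^ 2, X 1 ^ 2}) →ₐ[k] k) :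
    Module.finrank k (RingHom.ker π).Cotangent = 2 :=
  ProRep.powerSeries_finrank_kerCotangent_quotient_eq _ (span_sq_sq_le_maximalIdeal_sq k) π

/-- **«`dim t_R = 2`» LITERALLY** ([FantechiManetti1998ObstructionCalculus, Def. 2.5]: `t_{h_R} = h_R(k[ε])` with
Schlessinger's vector space structure, the tree's `ArtinFunctor.tangentModule`): `dim_k h_R(k[ε]) = 2` for
`R = k[[x, y]]/(x² + y²)`, at the (unique) point `pt ∈ h_R(k)` (any field `k`).
[cite: FantechiManetti1998ObstructionCalculus, Def. 2.5 and Ex. 5.7 (iii)] [cite: Schlessinger1968, Lemma 2.10] -/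
theorem finrank_pointsTangent_quotient_sq_add_sq
    (pt : (ArtinFunctor.points (k := k) (P2 k ⧸ Ideal.span {(X 0 : P2 k) ^ 2 + X 1 ^ 2})).obj (ArtAlg.base k)) :
    letI := (ArtinFunctor.points (k := k) (P2 k ⧸ Ideal.span {(X 0 : P2 k) ^ 2 + X 1 ^ 2})).tangentAddCommGroup pt
      (fun a => ProRep.powerSeries_quotient_points_base_eq _ a pt) k
      (ArtinFunctor.points_isBijectiveAlong_sqZeroExtAug (P2 k ⧸ Ideal.span {(X 0 : P2 k) ^ 2 + X 1 ^ 2}) k)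
    letI := (ArtinFunctor.points (k := k) (P2 k ⧸ Ideal.span {(X 0 : P2 k) ^ 2 + X 1 ^ 2})).tangentModule pt
      (fun a => ProRep.powerSeries_quotient_points_base_eq _ a pt) k
      (ArtinFunctor.points_isBijectiveAlong_sqZeroExtAug (P2 k ⧸ Ideal.span {(X 0 : P2 k) ^ 2 + X 1 ^ 2}) k)
    Module.finrank k ((ArtinFunctor.points (k := k) (P2 k ⧸ Ideal.span {(X 0 : P2 k) ^ 2 + X 1 ^ 2})).obj
      (ArtAlg.sqZeroExt (k := k) k)) = 2 :=
  ProRep.powerSeries_finrank_pointsTangent_eq _ (span_sq_add_sq_le_maximalIdeal_sq k) pt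

/-- **«`dim t_S = 2`» LITERALLY**: `dim_k h_S(k[ε]) = 2` for `S = k[[x, y]]/(x², y²)` (any field `k`).
[cite: FantechiManetti1998ObstructionCalculus, Def. 2.5 and Ex. 5.7 (iii)] [cite: Schlessinger1968, Lemma 2.10] -/
theorem finrank_pointsTangent_quotient_sq_sq
    (pt : (ArtinFunctor.points (k := k) (P2 k ⧸ Ideal.span {(X 0 : P2 k) ^ 2, X 1 ^ 2})).obj (ArtAlg.base k)) :
    letI := (ArtinFunctor.points (k := k) (P2 k ⧸ Ideal.span {(X 0 : P2 k) ^ 2, X 1 ^ 2})).tangentAddCommGroup pt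
      (fun a => ProRep.powerSeries_quotient_points_base_eq _ a pt) k
      (ArtinFunctor.points_isBijectiveAlong_sqZeroExtAug (P2 k ⧸ Ideal.span {(X 0 : P2 k) ^ 2, X 1 ^ 2}) k)
    letI := (ArtinFunctor.points (k := k) (P2 k ⧸ Ideal.span {(X 0 : P2 k) ^ 2, X 1 ^ 2})).tangentModule pt
      (fun a => ProRep.powerSeries_quotient_points_base_eq _ a pt) k
      (ArtinFunctor.points_isBijectiveAlong_sqZeroExtAug (P2 k ⧸ Ideal.span {(X 0 : P2 k) ^ 2, X 1 ^ 2}) k)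
    Module.finrank k ((ArtinFunctor.points (k := k) (P2 k ⧸ Ideal.span {(X 0 : P2 k) ^ 2, X 1 ^ 2})).obj
      (ArtAlg.sqZeroExt (k := k) k)) = 2 :=
  ProRep.powerSeries_finrank_pointsTangent_eq _ (span_sq_sq_le_maximalIdeal_sq k) pt

/-! #### `dim R = 1` -/

/-- `x² + y² ≠ 0` in `k[[x, y]]` (its `x²`-coefficient is `1`). [cite: FantechiManetti1998ObstructionCalculus, Ex. 5.7 (iii)] -/
theorem sq_add_sq_ne_zero : (X 0 : P2 k) ^ 2 + X 1 ^ 2 ≠ 0 := fun h => by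
  classical
  have h1 := congrArg (coeff (Finsupp.single (0 : Fin 2) 2)) h
  have hne : (Finsupp.single (0 : Fin 2) 2 : Fin 2 →₀ ℕ) ≠ Finsupp.single 1 2 := fun h01 => by
    have := Finsupp.ext_iff.1 h01 0
    simp at this
  rw [map_add, MvPowerSeries.coeff_X_pow, MvPowerSeries.coeff_X_pow, if_pos rfl, if_neg hne, add_zero,
    map_zero] at h1
  exact one_ne_zero h1

/-- **«`dim R = 1`» for (iii)** (any field `k`): `dim k[[x, y]]/(x² + y²) = 1` — at least `2 − 1` by Krull's height
theorem for the single equation `x² + y² ∈ 𝔪_P` ([Matsumura1987, Thm. 13.6 (ii)], tree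
`ProRep.powerSeries_le_ringKrullDim_quotient_add_card`), at most `2 − 1` because the equation is nonzero in the domain
`k[[x, y]]` ([AtiyahMacdonald1969, Cor. 11.18], tree `ProRep.powerSeries_ringKrullDim_quotient_add_one_le`).
[cite: FantechiManetti1998ObstructionCalculus, Ex. 5.7 (iii) and Prop. 5.8] [cite: Matsumura1987, Thm. 13.6 (ii)]
[cite: AtiyahMacdonald1969, Cor. 11.18] -/
theorem ringKrullDim_quotient_sq_add_sq :
    ringKrullDim (P2 k ⧸ Ideal.span {(X 0 : P2 k) ^ 2 + X 1 ^ 2}) = 1 := by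
  classical
  have hsub : ((({(X 0 : P2 k) ^ 2 + X 1 ^ 2} : Finset (P2 k)) : Set (P2 k))) ⊆
      IsLocalRing.maximalIdeal (P2 k) := by
    rw [Finset.coe_singleton, Set.singleton_subset_iff, SetLike.mem_coe]
    exact (Ideal.pow_le_self two_ne_zero)
      (span_sq_add_sq_le_maximalIdeal_sq k (Ideal.subset_span (Set.mem_singleton _)))
  have h1 := ProRep.powerSeries_le_ringKrullDim_quotient_add_card (k := k) _ hsub
  rw [Finset.card_singleton, Finset.coe_singleton] at h1
  have h2 := ProRep.powerSeries_ringKrullDim_quotient_add_one_le (k := k)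
    (Ideal.span {(X 0 : P2 k) ^ 2 + X 1 ^ 2}) (by rw [Ne, Ideal.span_singleton_eq_bot]; exact sq_add_sq_ne_zero k)
  obtain ⟨d, hd⟩ := ProRep.powerSeries_exists_ringKrullDim_quotient_eq (k := k)
    (Ideal.span {(X 0 : P2 k) ^ 2 + X 1 ^ 2}) (span_sq_add_sq_ne_top k)
  rw [hd] at h1 h2 ⊢
  have h1' : 2 ≤ d + 1 := by exact_mod_cast h1
  have h2' : d + 1 ≤ 2 := by exact_mod_cast h2
  have hd1 : d = 1 := by omega
  rw [hd1]
  rfl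

/-! #### `dim S = 0` -/

/-- The monomial `x^a y^b` of `k[[x, y]]`. [folklore] -/
private theorem monomial_eq_X_pow_mul_X_pow (d : Fin 2 →₀ ℕ) :
    (monomial d (1 : k) : P2 k) = X 0 ^ d 0 * X 1 ^ d 1 := by
  have hd : d = Finsupp.single 0 (d 0) + Finsupp.single 1 (d 1) := by
    ext s
    fin_cases s <;> simp
  rw [X_pow_eq, X_pow_eq, MvPowerSeries.monomial_mul_monomial, mul_one, ← hd]

/-- `𝔪³_P ⊆ (x², y²)`, monomial by monomial: a monomial `x^a y^b` with `a + b = 3` has `a ≥ 2` or `b ≥ 2`.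
[cite: FantechiManetti1998ObstructionCalculus, Ex. 5.7 (iii)] -/
theorem monomial_mem_span_sq_sq_of_degree_eq_three (d : Fin 2 →₀ ℕ) (hd : d.degree = 3) :
    (monomial d (1 : k) : P2 k) ∈ Ideal.span {(X 0 : P2 k) ^ 2, X 1 ^ 2} := by
  have hsum : d 0 + d 1 = 3 := by rw [← hd, Finsupp.degree_eq_sum, Fin.sum_univ_two]
  rw [monomial_eq_X_pow_mul_X_pow]
  by_cases h0 : 2 ≤ d 0
  · obtain ⟨a, ha⟩ := Nat.exists_eq_add_of_le h0
    rw [ha, pow_add, mul_assoc]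
    exact Ideal.mul_mem_right _ _ (Ideal.subset_span (by simp))
  · have h1 : 2 ≤ d 1 := by omega
    obtain ⟨b, hb⟩ := Nat.exists_eq_add_of_le h1
    rw [hb, pow_add, mul_comm, mul_assoc]
    exact Ideal.mul_mem_right _ _ (Ideal.subset_span (by simp))

/-- `𝔪³_P ⊆ (x², y²)` on coefficients: a series with no monomials of degree `< 3` lies in `(x², y²)` (it is a finite
sum `∑_{|d| = 3} x^d h_d`, tree `T1Lifting.exists_eq_sum_monomial_mul`). [cite: FantechiManetti1998ObstructionCalculus, Ex. 5.7 (iii)] -/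
theorem mem_span_sq_sq_of_coeff_eq_zero (g : P2 k) (hg : ∀ e : Fin 2 →₀ ℕ, e.degree < 3 → coeff e g = 0) :
    g ∈ Ideal.span {(X 0 : P2 k) ^ 2, X 1 ^ 2} := by
  obtain ⟨D, h, hD, rfl⟩ := T1Lifting.exists_eq_sum_monomial_mul k 3 g hg
  exact Ideal.sum_mem _ fun d hd =>
    Ideal.mul_mem_right _ _ (monomial_mem_span_sq_sq_of_degree_eq_three k d (hD d hd))

/-- `S = k[[x, y]]/(x², y²)` is finite-dimensional over `k`: spanned by the classes of the monomials of degree `≤ 2`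
(every series is its quadratic truncation plus an element of `𝔪³_P ⊆ (x², y²)`).
[cite: FantechiManetti1998ObstructionCalculus, Ex. 5.7 (iii)] -/
theorem moduleFinite_quotient_sq_sq : Module.Finite k (P2 k ⧸ Ideal.span {(X 0 : P2 k) ^ 2, X 1 ^ 2}) := by
  classical
  set J : Ideal (P2 k) := Ideal.span {(X 0 : P2 k) ^ 2, X 1 ^ 2} with hJ
  set D : Finset (Fin 2 →₀ ℕ) := (Finsupp.finite_of_degree_le (σ := Fin 2) 2).toFinset with hD
  have hmemD : ∀ d, d ∈ D ↔ d.degree ≤ 2 := fun d => by rw [hD, Set.Finite.mem_toFinset]; rfl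
  refine ⟨Submodule.fg_def.2 ⟨↑(D.image fun d => Ideal.Quotient.mkₐ k J (monomial d (1 : k))),
    Finset.finite_toSet _, eq_top_iff.2 ?_⟩⟩
  rintro x -
  obtain ⟨f, rfl⟩ := Ideal.Quotient.mkₐ_surjective k J x
  -- the quadratic truncation of `f`
  set t : P2 k := ∑ d ∈ D, coeff d f • monomial d (1 : k) with ht
  have hrest : f - t ∈ J := by
    refine mem_span_sq_sq_of_coeff_eq_zero k _ fun e he => ?_
    rw [map_sub, ht, map_sum, Finset.sum_eq_single e, map_smul, MvPowerSeries.coeff_monomial_same, smul_eq_mul,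
      mul_one, sub_self]
    · intro d _ hde
      rw [map_smul, MvPowerSeries.coeff_monomial_ne hde.symm, smul_zero]
    · intro heD
      exact absurd ((hmemD e).2 (by omega)) heD
  have hft : Ideal.Quotient.mkₐ k J f = Ideal.Quotient.mkₐ k J t := by
    rw [Ideal.Quotient.mkₐ_eq_mk, Ideal.Quotient.mk_eq_mk_iff_sub_mem]
    exact hrest
  rw [hft, ht, map_sum]
  refine Submodule.sum_mem _ fun d hd => ?_
  rw [map_smul]
  exact Submodule.smul_mem _ _ (Submodule.subset_span (Finset.mem_image_of_mem _ hd))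

/-- `S = k[[x, y]]/(x², y²)` is Artinian (finite over `k`). [cite: FantechiManetti1998ObstructionCalculus, Ex. 5.7 (iii)] -/
theorem isArtinianRing_quotient_sq_sq : IsArtinianRing (P2 k ⧸ Ideal.span {(X 0 : P2 k) ^ 2, X 1 ^ 2}) :=
  haveI := moduleFinite_quotient_sq_sq k
  IsArtinianRing.of_finite k _

/-- **«`dim S = 0`» for (iii)** (any field `k`): `dim k[[x, y]]/(x², y²) = 0` — a nonzero Artinian ring
([AtiyahMacdonald1969, Thm. 8.5]). [cite: FantechiManetti1998ObstructionCalculus, Ex. 5.7 (iii) and Prop. 5.8]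
[cite: AtiyahMacdonald1969, Thm. 8.5] -/
theorem ringKrullDim_quotient_sq_sq : ringKrullDim (P2 k ⧸ Ideal.span {(X 0 : P2 k) ^ 2, X 1 ^ 2}) = 0 := by
  haveI := isArtinianRing_quotient_sq_sq k
  haveI : Nontrivial (P2 k ⧸ Ideal.span {(X 0 : P2 k) ^ 2, X 1 ^ 2}) :=
    Ideal.Quotient.nontrivial_iff.2 (span_sq_sq_ne_top k)
  exact (ringKrullDimZero_iff_ringKrullDim_eq_zero).1
    (isArtinianRing_iff_isNoetherianRing_krullDimLE_zero.1 (isArtinianRing_quotient_sq_sq k)).2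

/-! ### §3 [FM98] Lemma 5.4 (curve selection) needs `k = k̄`: `(R, x̄)` over an ordered field -/

/-- **`x̄ ∈ R = k[[x, y]]/(x² + y²)` is NOT NILPOTENT** (any field `k`): no power `x^m` lies in `(x² + y²)` — the
`k`-algebra map `Φ : k[[x, y]] → K[[t]]`, `x ↦ t`, `y ↦ j·t`, over the ring `K = k[j]/(j² + 1)` kills
`x² + y² ↦ (1 + j²) t² = 0` but sends `x^m` to `t^m ≠ 0`. (So `√(x² + y²) ≠ 𝔪_P = √(x², y²)`: the hypothesis «`g ∈ 𝔪_R`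
a non-nilpotent element» of [FantechiManetti1998ObstructionCalculus, Lemma 5.4] holds for `g = x̄`.)
[cite: FantechiManetti1998ObstructionCalculus, Lemma 5.4 and Ex. 5.7 (iii)] -/
theorem X_pow_not_mem_span_sq_add_sq (m : ℕ) :
    (X 0 : P2 k) ^ m ∉ Ideal.span {(X 0 : P2 k) ^ 2 + X 1 ^ 2} := by
  classical
  intro hmem
  -- the ring `K = k[j]/(j² + 1)`
  let f : Polynomial k := Polynomial.X ^ 2 + Polynomial.C 1
  have hf : f.degree ≠ 0 := by
    show (Polynomial.X ^ 2 + Polynomial.C (1 : k)).degree ≠ 0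
    rw [Polynomial.degree_X_pow_add_C two_pos]
    exact Ne.symm (ne_of_lt (by exact_mod_cast (two_pos : (0 : ℕ) < 2)))
  haveI : Nontrivial (AdjoinRoot f) := AdjoinRoot.nontrivial f hf
  have hj : (AdjoinRoot.root f) ^ 2 + 1 = 0 := by
    have h := AdjoinRoot.eval₂_root f
    rwa [Polynomial.eval₂_add, Polynomial.eval₂_X_pow, Polynomial.eval₂_C, map_one] at h
  -- the substitution `x ↦ t`, `y ↦ j t`
  let a : Fin 2 → PowerSeries (AdjoinRoot f) :=
    ![PowerSeries.X, PowerSeries.C (AdjoinRoot.root f) * PowerSeries.X]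
  have ha0 : a 0 = PowerSeries.X := rfl
  have ha1 : a 1 = PowerSeries.C (AdjoinRoot.root f) * PowerSeries.X := rfl
  have ha : MvPowerSeries.HasSubst a := MvPowerSeries.hasSubst_of_constantCoeff_zero fun s => by
    fin_cases s
    · change PowerSeries.constantCoeff (PowerSeries.X : PowerSeries (AdjoinRoot f)) = 0
      exact PowerSeries.constantCoeff_X
    · change PowerSeries.constantCoeff (PowerSeries.C (AdjoinRoot.root f) * PowerSeries.X) = 0
      rw [map_mul, PowerSeries.constantCoeff_X, mul_zero]
  let Φ : P2 k →ₐ[k] PowerSeries (AdjoinRoot f) := MvPowerSeries.substAlgHom ha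
  have hΦ0 : Φ (X 0) = PowerSeries.X := by rw [MvPowerSeries.substAlgHom_X, ha0]
  have hΦ1 : Φ (X 1) = PowerSeries.C (AdjoinRoot.root f) * PowerSeries.X := by rw [MvPowerSeries.substAlgHom_X, ha1]
  have hkill : Φ ((X 0 : P2 k) ^ 2 + X 1 ^ 2) = 0 := by
    rw [map_add, map_pow, map_pow, hΦ0, hΦ1]
    calc (PowerSeries.X : PowerSeries (AdjoinRoot f)) ^ 2 + (PowerSeries.C (AdjoinRoot.root f) * PowerSeries.X) ^ 2
        = PowerSeries.C ((AdjoinRoot.root f) ^ 2 + 1) * PowerSeries.X ^ 2 := by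
          rw [map_add, map_one, map_pow]; ring
      _ = 0 := by rw [hj, map_zero, zero_mul]
  obtain ⟨g, hg⟩ := Ideal.mem_span_singleton'.1 hmem
  have h := congrArg Φ hg
  rw [map_mul, hkill, mul_zero, map_pow, hΦ0] at h
  have h2 := congrArg (PowerSeries.coeff m) h
  rw [map_zero, PowerSeries.coeff_X_pow, if_pos rfl] at h2
  exact zero_ne_one h2

/-- `x̄^m ≠ 0` in `R = k[[x, y]]/(x² + y²)` for every `m` (any field): `x̄` is a non-nilpotent element.
[cite: FantechiManetti1998ObstructionCalculus, Lemma 5.4 and Ex. 5.7 (iii)] -/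
theorem mk_X_pow_ne_zero (m : ℕ) :
    (Ideal.Quotient.mk (Ideal.span {(X 0 : P2 k) ^ 2 + X 1 ^ 2}) (X 0)) ^ m ≠ 0 := by
  rw [← map_pow, Ne, Ideal.Quotient.eq_zero_iff_mem]
  exact X_pow_not_mem_span_sq_add_sq k m

/-- `x̄, ȳ ∈ 𝔪_R`, i.e. they are non-units of `R = k[[x, y]]/(x² + y²)` (any field): «`g ∈ 𝔪_R`» of
[FantechiManetti1998ObstructionCalculus, Lemma 5.4] for `g = x̄`. [cite: FantechiManetti1998ObstructionCalculus, Lemma 5.4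
and Ex. 5.7 (iii)] -/
theorem mk_X_not_isUnit (s : Fin 2) :
    ¬ IsUnit (Ideal.Quotient.mk (Ideal.span {(X 0 : P2 k) ^ 2 + X 1 ^ 2}) (X s)) := by
  rintro ⟨u, hu⟩
  obtain ⟨g, hg⟩ := Ideal.Quotient.mk_surjective (↑u⁻¹ : P2 k ⧸ Ideal.span {(X 0 : P2 k) ^ 2 + X 1 ^ 2})
  have h1 : Ideal.Quotient.mk (Ideal.span {(X 0 : P2 k) ^ 2 + X 1 ^ 2}) (X s * g) = 1 := by
    rw [map_mul, hg, ← hu, Units.mul_inv]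
  rw [← (Ideal.Quotient.mk (Ideal.span {(X 0 : P2 k) ^ 2 + X 1 ^ 2})).map_one, Ideal.Quotient.eq] at h1
  have hm : X s * g - 1 ∈ IsLocalRing.maximalIdeal (P2 k) :=
    ((span_sq_add_sq_le_maximalIdeal_sq k).trans (Ideal.pow_le_self two_ne_zero)) h1
  have h1m : (1 : P2 k) ∈ IsLocalRing.maximalIdeal (P2 k) := by
    have := sub_mem (Ideal.mul_mem_right g _ (X_mem_maximalIdeal k s)) hm
    rwa [sub_sub_cancel] at this
  exact (IsLocalRing.maximalIdeal.isMaximal (P2 k)).ne_top (Ideal.eq_top_of_isUnit_mem _ h1m isUnit_one)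

/-! ### §5 «`S_red → R_red` is smooth» (the first conclusion of Prop. 5.8) FAILS for (iii), any field:
`R_red = k[[x, y]]/√(x² + y²) → S_red = k[[x, y]]/√(x², y²) = k` is not smooth — `R_red` has a nonzero tangent vector -/

/-- `x, y ∈ √(x², y²)`. [cite: FantechiManetti1998ObstructionCalculus, Ex. 5.7 (iii)] -/
theorem X_mem_radical_span_sq_sq (s : Fin 2) :
    (X s : P2 k) ∈ (Ideal.span {(X 0 : P2 k) ^ 2, X 1 ^ 2}).radical :=
  Ideal.mem_radical_iff.2 ⟨2, Ideal.subset_span (by fin_cases s <;> simp)⟩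

/-- **`S_red = k`**: `√(x², y²) = 𝔪_P = (x, y)`, so `S_red = k[[x, y]]/√(x², y²)` is the residue field.
[cite: FantechiManetti1998ObstructionCalculus, Ex. 5.7 (iii) and Prop. 5.8] -/
theorem radical_span_sq_sq_eq_maximalIdeal :
    (Ideal.span {(X 0 : P2 k) ^ 2, X 1 ^ 2}).radical = IsLocalRing.maximalIdeal (P2 k) := by
  refine le_antisymm ?_ ?_
  · rw [← (IsLocalRing.maximalIdeal.isMaximal (P2 k)).isPrime.radical]
    exact Ideal.radical_mono ((span_sq_sq_le_maximalIdeal_sq k).trans (Ideal.pow_le_self two_ne_zero))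
  · rw [Literature.AlgebraicGeometry.Resolution.maximalIdeal_mvPowerSeries_eq_span, Ideal.span_le]
    rintro _ ⟨s, rfl⟩
    exact X_mem_radical_span_sq_sq k s

/-- `√(x² + y²) ⊆ 𝔪_P`. [cite: FantechiManetti1998ObstructionCalculus, Ex. 5.7 (iii)] -/
theorem radical_span_sq_add_sq_le_maximalIdeal :
    (Ideal.span {(X 0 : P2 k) ^ 2 + X 1 ^ 2}).radical ≤ IsLocalRing.maximalIdeal (P2 k) := by
  rw [← (IsLocalRing.maximalIdeal.isMaximal (P2 k)).isPrime.radical]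
  exact Ideal.radical_mono ((span_sq_add_sq_le_maximalIdeal_sq k).trans (Ideal.pow_le_self two_ne_zero))

/-- `√(x² + y²) ≠ P`. [cite: FantechiManetti1998ObstructionCalculus, Ex. 5.7 (iii)] -/
theorem radical_span_sq_add_sq_ne_top : (Ideal.span {(X 0 : P2 k) ^ 2 + X 1 ^ 2}).radical ≠ ⊤ := fun h =>
  (IsLocalRing.maximalIdeal.isMaximal (P2 k)).ne_top
    (top_le_iff.1 (h.symm.le.trans (radical_span_sq_add_sq_le_maximalIdeal k)))

/-- `√(x², y²) ≠ P`. [cite: FantechiManetti1998ObstructionCalculus, Ex. 5.7 (iii)] -/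
theorem radical_span_sq_sq_ne_top : (Ideal.span {(X 0 : P2 k) ^ 2, X 1 ^ 2}).radical ≠ ⊤ := by
  rw [radical_span_sq_sq_eq_maximalIdeal]
  exact (IsLocalRing.maximalIdeal.isMaximal (P2 k)).ne_top

/-- `x ∉ √(x² + y²)` (any field): `x̄ ≠ 0` in `R_red` — §3's non-nilpotency.
[cite: FantechiManetti1998ObstructionCalculus, Lemma 5.4 and Ex. 5.7 (iii)] -/
theorem X_not_mem_radical_span_sq_add_sq :
    (X 0 : P2 k) ∉ (Ideal.span {(X 0 : P2 k) ^ 2 + X 1 ^ 2}).radical := fun h => by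
  obtain ⟨m, hm⟩ := Ideal.mem_radical_iff.1 h
  exact X_pow_not_mem_span_sq_add_sq k m hm

/-- **`R_red` and `S_red` of (iii)** as `k[[x, y]]/√(x² + y²)` and `k[[x, y]]/√(x², y²)`: each is the reduction
`(P/I)/nil(P/I)` of the corresponding ring of Example 5.7 (iii) (third isomorphism theorem) and is reduced.
[cite: FantechiManetti1998ObstructionCalculus, Prop. 5.8 and Ex. 5.7 (iii)] -/
theorem reduced_presentations :
    (Nonempty (((P2 k ⧸ Ideal.span {(X 0 : P2 k) ^ 2 + X 1 ^ 2}) ⧸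
          nilradical (P2 k ⧸ Ideal.span {(X 0 : P2 k) ^ 2 + X 1 ^ 2})) ≃ₐ[k]
        P2 k ⧸ (Ideal.span {(X 0 : P2 k) ^ 2 + X 1 ^ 2}).radical) ∧
      IsReduced (P2 k ⧸ (Ideal.span {(X 0 : P2 k) ^ 2 + X 1 ^ 2}).radical)) ∧
    (Nonempty (((P2 k ⧸ Ideal.span {(X 0 : P2 k) ^ 2, X 1 ^ 2}) ⧸
          nilradical (P2 k ⧸ Ideal.span {(X 0 : P2 k) ^ 2, X 1 ^ 2})) ≃ₐ[k]
        P2 k ⧸ (Ideal.span {(X 0 : P2 k) ^ 2, X 1 ^ 2}).radical) ∧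
      IsReduced (P2 k ⧸ (Ideal.span {(X 0 : P2 k) ^ 2, X 1 ^ 2}).radical)) :=
  ⟨ProRep.nonempty_quotient_nilradical_algEquiv_quotient_radical _,
    ProRep.nonempty_quotient_nilradical_algEquiv_quotient_radical _⟩

/-- `R_red = k[[x, y]]/√(x² + y²)` is local. [cite: FantechiManetti1998ObstructionCalculus, Ex. 5.7 (iii)] -/
theorem isLocalRing_quotient_radical_span_sq_add_sq :
    IsLocalRing (P2 k ⧸ (Ideal.span {(X 0 : P2 k) ^ 2 + X 1 ^ 2}).radical) :=
  ProRep.isLocalRing_quotient _ (radical_span_sq_add_sq_ne_top k)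

/-- **`R_red` is NOT a field** (`𝔪_{R_red} ≠ 0`: it contains `x̄ ≠ 0`), any field `k` — whereas `S_red = k`.
[cite: FantechiManetti1998ObstructionCalculus, Prop. 5.8 and Ex. 5.7 (iii)] -/
theorem not_isField_quotient_radical_span_sq_add_sq :
    ¬ IsField (P2 k ⧸ (Ideal.span {(X 0 : P2 k) ^ 2 + X 1 ^ 2}).radical) := by
  intro hF
  have hx0 : Ideal.Quotient.mk (Ideal.span {(X 0 : P2 k) ^ 2 + X 1 ^ 2}).radical (X 0 : P2 k) ≠ 0 := by
    rw [Ne, Ideal.Quotient.eq_zero_iff_mem]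
    exact X_not_mem_radical_span_sq_add_sq k
  obtain ⟨y, hy⟩ := hF.mul_inv_cancel hx0
  obtain ⟨g, rfl⟩ := Ideal.Quotient.mk_surjective y
  rw [← map_mul, ← (Ideal.Quotient.mk _).map_one, Ideal.Quotient.eq] at hy
  have hm : X 0 * g - 1 ∈ IsLocalRing.maximalIdeal (P2 k) := radical_span_sq_add_sq_le_maximalIdeal k hy
  have h1m : (1 : P2 k) ∈ IsLocalRing.maximalIdeal (P2 k) := by
    have := sub_mem (Ideal.mul_mem_right g _ (X_mem_maximalIdeal k 0)) hm
    rwa [sub_sub_cancel] at this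
  exact (IsLocalRing.maximalIdeal.isMaximal (P2 k)).ne_top (Ideal.eq_top_of_isUnit_mem _ h1m isUnit_one)

/-- **`R_red` has a NONZERO TANGENT VECTOR** (any field `k`): for every augmentation `π` of
`R_red = k[[x, y]]/√(x² + y²)` there is a `k`-algebra map `ψ : R_red → k[ε]` over `π` whose `ε`-part does not vanish
on both `x̄, ȳ` — i.e. `ψ` is not the trivial point `a ↦ π(a)`. Proof: `R_red` is Noetherian local and not a field, so
`𝔪/𝔪² ≠ 0` (Nakayama, Mathlib's `IsLocalRing.subsingleton_cotangentSpace_iff`); a functional `ℓ ≠ 0` on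
`(ker π)/(ker π)² = 𝔪/𝔪²` gives the tangent vector `ψ = ofDual ℓ : a ↦ π(a) + ℓ[a − π(a)]ε` (the tree's
`TangentHom.ofDual`, [Mazur1997Deformation, §15]); if its `ε`-part vanished on `x̄, ȳ` it would agree with `ofDual 0`
on the topological generators, hence everywhere (`T1Lifting.mvPowerSeries_algHom_ext`), forcing `ℓ = 0`.
[cite: FantechiManetti1998ObstructionCalculus, Def. 2.5, Prop. 5.8 and Ex. 5.7 (iii)] [cite: Mazur1997Deformation, §15] -/
theorem exists_point_dualNumber_ne_trivial
    (π : (P2 k ⧸ (Ideal.span {(X 0 : P2 k) ^ 2 + X 1 ^ 2}).radical) →ₐ[k] k) :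
    ∃ ψ : (P2 k ⧸ (Ideal.span {(X 0 : P2 k) ^ 2 + X 1 ^ 2}).radical) →ₐ[k] DualNumber k,
      (∀ a, (ψ a).fst = π a) ∧
        ∃ s : Fin 2, (ψ (Ideal.Quotient.mk _ (X s))).snd ≠ 0 := by
  classical
  haveI : IsLocalRing (P2 k ⧸ (Ideal.span {(X 0 : P2 k) ^ 2 + X 1 ^ 2}).radical) :=
    isLocalRing_quotient_radical_span_sq_add_sq k
  haveI : IsNoetherianRing (P2 k) :=
    Literature.AlgebraicGeometry.Resolution.isNoetherianRing_mvPowerSeries k (Fin 2)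
  -- `𝔪/𝔪² ≠ 0`: `R_red` is not a field
  have hns : ¬ Subsingleton (IsLocalRing.CotangentSpace
      (P2 k ⧸ (Ideal.span {(X 0 : P2 k) ^ 2 + X 1 ^ 2}).radical)) := fun hs =>
    not_isField_quotient_radical_span_sq_add_sq k (IsLocalRing.subsingleton_cotangentSpace_iff.1 hs)
  obtain ⟨v0, hv0⟩ : ∃ v : IsLocalRing.CotangentSpace
      (P2 k ⧸ (Ideal.span {(X 0 : P2 k) ^ 2 + X 1 ^ 2}).radical), v ≠ 0 := by
    rw [not_subsingleton_iff_nontrivial] at hns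
    exact exists_ne 0
  -- transported to the augmentation ideal `ker π = 𝔪`
  obtain ⟨v, hv⟩ : ∃ v : (RingHom.ker π).Cotangent, v ≠ 0 := by
    rw [Literature.RingTheory.CompleteLocalRings.TangentHom.ker_eq_maximalIdeal π]
    exact ⟨v0, hv0⟩
  -- a functional not killing `v`
  obtain ⟨ℓ, hℓ⟩ : ∃ ℓ : Module.Dual k (RingHom.ker π).Cotangent, ℓ v ≠ 0 := by
    by_contra hall
    push Not at hall
    exact hv ((Module.forall_dual_apply_eq_zero_iff k v).1 hall)
  let ψ := Literature.RingTheory.CompleteLocalRings.TangentHom.ofDual (π := π) ℓ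
  refine ⟨ψ.1, ψ.2, ?_⟩
  by_contra hnone
  push Not at hnone
  -- then `ψ` agrees with the trivial tangent vector on `x̄, ȳ`, hence everywhere
  let ψ0 := Literature.RingTheory.CompleteLocalRings.TangentHom.ofDual (π := π) 0
  have hX : ∀ s : Fin 2, ψ.1 (Ideal.Quotient.mk _ (X s)) = ψ0.1 (Ideal.Quotient.mk _ (X s)) := fun s => by
    refine TrivSqZeroExt.ext ?_ ?_
    · rw [ψ.2, ψ0.2]
    · rw [hnone s, Literature.RingTheory.CompleteLocalRings.TangentHom.ofDual_apply, TrivSqZeroExt.snd_add,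
        TrivSqZeroExt.snd_inl, TrivSqZeroExt.snd_inr, LinearMap.zero_apply, add_zero]
  have hcomp : ψ.1.comp (Ideal.Quotient.mkₐ k _) = ψ0.1.comp (Ideal.Quotient.mkₐ k _) :=
    T1Lifting.mvPowerSeries_algHom_ext k (ArtAlg.sqZeroExt (k := k) k)
      (ψ.1.comp (Ideal.Quotient.mkₐ k _)) (ψ0.1.comp (Ideal.Quotient.mkₐ k _)) fun s => hX s
  have heq : ψ.1 = ψ0.1 := Ideal.Quotient.algHom_ext k hcomp
  have hℓ0 : ℓ = 0 :=
    (Literature.RingTheory.CompleteLocalRings.TangentHom.equivDual (π := π)).symm.injective (Subtype.ext heq)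
  exact hℓ (by rw [hℓ0, LinearMap.zero_apply])

/-- **[FantechiManetti1998ObstructionCalculus, Prop. 5.8], FIRST CONCLUSION «`S_red → R_red` is smooth», FAILS for
Example 5.7 (iii)** (any field `k`; with the letters of 5.8 matched to (iii) as in `prop58_fails`: print's `S → R` is
(iii)'s `R → S`, so the claim is that `ρ : R_red → S_red` is smooth, `R_red = k[[x, y]]/√(x² + y²)`,
`S_red = k[[x, y]]/√(x², y²) = k`). Smoothness of a morphism in `Ârt_k` is smoothness of the induced
`h_{S_red} → h_{R_red}` ([FantechiManetti1998ObstructionCalculus, Def. 2.15]: «A morphism `ν : F → G` in Fun is smooth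
if, for every `e ∈ Smex`, `e : 0 → M → B → A → 0` the natural map `F(B) → ν̃(e)` is surjective», `ν̃(e)` the fibre
product `F(A) ×_{G(A)} G(B)`, p. 548), and it FAILS on the small extension `k[ε] → k`: there are a point
`a ∈ h_{S_red}(k)` and a point `b ∈ h_{R_red}(k[ε])` over the same point of `h_{R_red}(k)` (`fst ∘ b = a ∘ ρ`) with NO
`b' ∈ h_{S_red}(k[ε])` over both — `b` is a nonzero tangent vector of `R_red` (`exists_point_dualNumber_ne_trivial`),
while every `b' ∘ ρ` kills `x̄, ȳ` (they die in `S_red`). (Smoothness of a morphism of `Ârt_k` is read as smoothness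
of the induced morphism of functors of points — [FantechiManetti1998ObstructionCalculus]'s own usage: Lemma 5.6 (i),
p. 561 «the functor `h_R` is smooth (hence `R` is a power series algebra)», and the proof of Prop. 5.8, p. 562, which
reduces «`S_red → R_red` is smooth» to `R_red` being a power series ring over `S_red`; cf. [Schlessinger1968, Def. 2.2]
and the power-series criterion [Schlessinger1968, Prop. 2.5 (i)] «`h_S → h_R` is smooth if and only if `S` is a power
series ring over `R`».)
[cite: FantechiManetti1998ObstructionCalculus, Def. 2.15, Prop. 5.8 and Ex. 5.7 (iii) (p. 562)]
[cite: Schlessinger1968, Def. 2.2] -/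
theorem reducedMap_not_smooth :
    ∃ (a : (P2 k ⧸ (Ideal.span {(X 0 : P2 k) ^ 2, X 1 ^ 2}).radical) →ₐ[k] k)
      (b : (P2 k ⧸ (Ideal.span {(X 0 : P2 k) ^ 2 + X 1 ^ 2}).radical) →ₐ[k] DualNumber k),
      (TrivSqZeroExt.fstHom k k k).comp b =
          a.comp (Ideal.Quotient.factorₐ k (Ideal.radical_mono (span_le k))) ∧
        ¬ ∃ b' : (P2 k ⧸ (Ideal.span {(X 0 : P2 k) ^ 2, X 1 ^ 2}).radical) →ₐ[k] DualNumber k,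
          (TrivSqZeroExt.fstHom k k k).comp b' = a ∧
            b'.comp (Ideal.Quotient.factorₐ k (Ideal.radical_mono (span_le k))) = b := by
  obtain ⟨a⟩ : Nonempty ((P2 k ⧸ (Ideal.span {(X 0 : P2 k) ^ 2, X 1 ^ 2}).radical) →ₐ[k] k) :=
    ⟨ProRep.quotientAug (ProRep.mvPowerSeriesAug k 2) _ (radical_span_sq_sq_ne_top k)⟩
  obtain ⟨ψ, hψ, s, hs⟩ := exists_point_dualNumber_ne_trivial k
    (a.comp (Ideal.Quotient.factorₐ k (Ideal.radical_mono (span_le k))))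
  refine ⟨a, ψ, ?_, ?_⟩
  · apply AlgHom.ext
    intro r
    exact hψ r
  · rintro ⟨b', -, hb'ψ⟩
    apply hs
    rw [← hb'ψ, AlgHom.comp_apply, Ideal.Quotient.factorₐ_apply_mk,
      Ideal.Quotient.eq_zero_iff_mem.2 (X_mem_radical_span_sq_sq k s), map_zero, TrivSqZeroExt.snd_zero]

variable [LinearOrder k] [IsStrictOrderedRing k]

/-- **EVERY arc of `R = k[[x, y]]/(x² + y²)` kills `x̄` and `ȳ`** (`k` ordered; print `k = ℝ`): for every `k`-algebra
map `c : R → k[[t]]` — in particular every local homomorphism of [FantechiManetti1998ObstructionCalculus, Lemma 5.4] —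
`c(x̄) = c(ȳ) = 0`, since `c(x̄)² + c(ȳ)² = 0` in `k[[t]]`. [cite: FantechiManetti1998ObstructionCalculus, Lemma 5.4 and
Ex. 5.7 (iii)] -/
theorem curve_apply_mk_X_eq_zero
    (c : (P2 k ⧸ Ideal.span {(X 0 : P2 k) ^ 2 + X 1 ^ 2}) →ₐ[k] PowerSeries k) (s : Fin 2) :
    c (Ideal.Quotient.mk (Ideal.span {(X 0 : P2 k) ^ 2 + X 1 ^ 2}) (X s)) = 0 := by
  have h0 : (c.comp (Ideal.Quotient.mkₐ k (Ideal.span {(X 0 : P2 k) ^ 2 + X 1 ^ 2})))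
      ((X 0 : P2 k) ^ 2 + X 1 ^ 2) = 0 := by
    rw [AlgHom.comp_apply, Ideal.Quotient.mkₐ_eq_mk,
      Ideal.Quotient.eq_zero_iff_mem.2 (Ideal.subset_span (Set.mem_singleton _)), map_zero]
  have h := T1Lifting.algHom_X_eq_zero_of_map_sq_add_sq_eq_zero k _ h0 s
  rwa [AlgHom.comp_apply, Ideal.Quotient.mkₐ_eq_mk] at h

/-- **[FantechiManetti1998ObstructionCalculus, LEMMA 5.4] (Curve Selection Lemma) NEEDS «`k` algebraically closed»**
(this file's remark; the mechanism of print's «if `k` is not algebraically closed then Proposition 5.8 may fail, cf.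
Example 5.7 (iii)», Prop. 5.8 being proved from Lemma 5.4): over an ORDERED field `k`, for `R = k[[x, y]]/(x² + y²)` of
Example 5.7 (iii) and `g = x̄`: `g` is a non-unit (`∈ 𝔪_R`), `g` is not nilpotent, and yet EVERY `k`-algebra map
`c : R → k[[t]]` has `c(g) = 0` — the printed conclusion «there is a local homomorphism `c : R → k[[t]]` such that
`c(g) ≠ 0`» fails. [cite: FantechiManetti1998ObstructionCalculus, Lemma 5.4 and Ex. 5.7 (iii)] -/
theorem curveSelection_fails :
    ¬ IsUnit (Ideal.Quotient.mk (Ideal.span {(X 0 : P2 k) ^ 2 + X 1 ^ 2}) (X 0)) ∧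
    (∀ m : ℕ, (Ideal.Quotient.mk (Ideal.span {(X 0 : P2 k) ^ 2 + X 1 ^ 2}) (X 0)) ^ m ≠ 0) ∧
    ∀ c : (P2 k ⧸ Ideal.span {(X 0 : P2 k) ^ 2 + X 1 ^ 2}) →ₐ[k] PowerSeries k,
      c (Ideal.Quotient.mk (Ideal.span {(X 0 : P2 k) ^ 2 + X 1 ^ 2}) (X 0)) = 0 :=
  ⟨mk_X_not_isUnit k 0, mk_X_pow_ne_zero k, fun c => curve_apply_mk_X_eq_zero k c 0⟩

/-! ### §4 «if `k` is not algebraically closed then Proposition 5.8 may fail, cf. Example 5.7 (iii)» -/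

/-- **[FantechiManetti1998ObstructionCalculus, p. 562]: «Note also that if `k` is not algebraically closed then
Proposition 5.8 may fail, cf. Example 5.7 (iii).»** — typed for every linearly ordered field `k` (print `k = ℝ`). For
the morphism `R = k[[x, y]]/(x² + y²) → S = k[[x, y]]/(x², y²)` of Example 5.7 (iii) (print's «`S → R`» of Prop. 5.8,
whose hypothesis is on «`h_R → h_S`» = (iii)'s `h_S → h_R`): (1) the HYPOTHESIS of Prop. 5.8 holds — `h_S → h_R` has the
relative curvilinear lifting property («no relative curvilinear obstructions»; the tree's
`FM98Example57iii.relative_curvilinear_lifting` of `RelativeCurvilinearLiftingNonClosedField.lean`, restated); (2) the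
numbers: `dim R = 1`, `dim S = 0`, and for every augmentation `dim t_R = dim t_S = 2` (augmentations exist) — so the
CONCLUSION «`dim R − dim S = dim t_R − dim t_S`» of Prop. 5.8, which for this morphism reads
`dim S − dim R = dim t_S − dim t_R`, is `0 − 1 = 2 − 2`, false (`prop58_dimensionFormula_fails`).
[cite: FantechiManetti1998ObstructionCalculus, Prop. 5.8 and Ex. 5.7 (iii) (p. 562)] -/
theorem prop58_fails :
    (∀ (N : ℕ)
        (a : (P2 k ⧸ Ideal.span {(X 0 : P2 k) ^ 2, X 1 ^ 2}) →ₐ[k] T1Lifting.A k N)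
        (b : (P2 k ⧸ Ideal.span {(X 0 : P2 k) ^ 2 + X 1 ^ 2}) →ₐ[k] T1Lifting.A k (N + 1)),
        (T1Lifting.i k N).comp b = a.comp (Ideal.Quotient.factorₐ k (span_le k)) →
        ∃ b' : (P2 k ⧸ Ideal.span {(X 0 : P2 k) ^ 2, X 1 ^ 2}) →ₐ[k] T1Lifting.A k (N + 1),
          (T1Lifting.i k N).comp b' = a ∧ b'.comp (Ideal.Quotient.factorₐ k (span_le k)) = b) ∧
    ringKrullDim (P2 k ⧸ Ideal.span {(X 0 : P2 k) ^ 2 + X 1 ^ 2}) = 1 ∧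
    ringKrullDim (P2 k ⧸ Ideal.span {(X 0 : P2 k) ^ 2, X 1 ^ 2}) = 0 ∧
    Nonempty ((P2 k ⧸ Ideal.span {(X 0 : P2 k) ^ 2 + X 1 ^ 2}) →ₐ[k] k) ∧
    Nonempty ((P2 k ⧸ Ideal.span {(X 0 : P2 k) ^ 2, X 1 ^ 2}) →ₐ[k] k) ∧
    (∀ π : (P2 k ⧸ Ideal.span {(X 0 : P2 k) ^ 2 + X 1 ^ 2}) →ₐ[k] k,
        Module.finrank k (RingHom.ker π).Cotangent = 2) ∧
    (∀ π : (P2 k ⧸ Ideal.span {(X 0 : P2 k) ^ 2, X 1 ^ 2}) →ₐ[k] k,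
        Module.finrank k (RingHom.ker π).Cotangent = 2) :=
  ⟨fun N a b hab => relative_curvilinear_lifting k N a b hab, ringKrullDim_quotient_sq_add_sq k,
    ringKrullDim_quotient_sq_sq k, ProRep.powerSeries_quotient_nonempty_aug _ (span_sq_add_sq_le_maximalIdeal_sq k),
    ProRep.powerSeries_quotient_nonempty_aug _ (span_sq_sq_le_maximalIdeal_sq k),
    finrank_kerCotangent_quotient_sq_add_sq k, finrank_kerCotangent_quotient_sq_sq k⟩

omit [LinearOrder k] [IsStrictOrderedRing k] in
/-- **The dimension formula of [FantechiManetti1998ObstructionCalculus, Prop. 5.8] FAILS for Example 5.7 (iii)**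
(any field for the numbers; the hypothesis of 5.8 needs `k` ordered, `prop58_fails`): written without subtraction,
«`dim S − dim R = dim t_S − dim t_R`» would be `dim S + dim t_R = dim R + dim t_S`; here the left side is `0 + 2` and
the right side `1 + 2`, for every choice of augmentations computing `t_R`, `t_S`.
[cite: FantechiManetti1998ObstructionCalculus, Prop. 5.8 and Ex. 5.7 (iii) (p. 562)] -/
theorem prop58_dimensionFormula_fails
    (πR : (P2 k ⧸ Ideal.span {(X 0 : P2 k) ^ 2 + X 1 ^ 2}) →ₐ[k] k)
    (πS : (P2 k ⧸ Ideal.span {(X 0 : P2 k) ^ 2, X 1 ^ 2}) →ₐ[k] k) :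
    ringKrullDim (P2 k ⧸ Ideal.span {(X 0 : P2 k) ^ 2, X 1 ^ 2}) +
        (Module.finrank k (RingHom.ker πR).Cotangent : WithBot ℕ∞) ≠
      ringKrullDim (P2 k ⧸ Ideal.span {(X 0 : P2 k) ^ 2 + X 1 ^ 2}) +
        (Module.finrank k (RingHom.ker πS).Cotangent : WithBot ℕ∞) := by
  rw [ringKrullDim_quotient_sq_sq, ringKrullDim_quotient_sq_add_sq, finrank_kerCotangent_quotient_sq_add_sq,
    finrank_kerCotangent_quotient_sq_sq]
  exact fun h => absurd (by exact_mod_cast h : (0 : ℕ) + 2 = 1 + 2) (by norm_num)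

end FM98Example57iii

end Literature.AlgebraicGeometry.Deformation
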